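import Summits.PneNP.PneNP.Theses.RamseyUncertifiable
import Summits.PneNP.PneNP.Theorems.RegularResolutionRung.Negative.OneSidedFalse
import Literature.Computability.MetaComplexity.ResolutionRestrictionMap
import Literature.Computability.MetaComplexity.ResolutionProofs

/-!
# Line `indelible-zero-banks` — crux `RamseyUncertifiable.RegularResolutionRung` (stmt-PneNP-9818)

Crux (FIXED, the route's decl; read back through the landed `Negative.cliqueCNF`, to which it is
definitionally equal — `Negative.regularResolutionRung_iff_restated` is `Iff.rfl`): there are `ε > 0`,
`n₀` such that for every graph `G` on `n ≥ n₀` vertices and every pair of REGULAR resolution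
refutations `π₁` of the unary clique formula `Clique(G, ⌈2log₂ n⌉)` and `π₂` of `Clique(Ḡ, ⌈2log₂ n⌉)`,
`n ^ (ε log₂ n) ≤ max |π₁| |π₂|` (ABdRLNR arXiv:2012.09476 §9, symmetric form).

Idea `indelible-zero-banks` (crux-ideate r1, ideator 1; triage r1-1/2/3: pass ×3). On a path of a
read-once branching program (= regular refutation) that ends at the clique axiom of block `i*`, no
`x_{i*,·}` is ever forgotten (PERSISTENCE), so every node carries a canonical BANK
`Q(c) ⊆ V` of indelible block-`i*` zeros, read off its clause; the UPPER half of Prömel–Rödl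
bi-density — the inequality LPRT explicitly discard (arXiv:1303.3166 p. 9) — pins every accepted
vertex whose shadow has been banked to `< m^{1-β}` node-determined candidates (SHADOW PINNING), and
after a ONE-WIDTH NORMAL FORM (random induced restriction: every node remembers `≤ γ log₂ m` ones,
so ABdRLNR's Case 1 is empty and cheap paths must forget) the count of distinct banks forced on cheap
paths is the lower bound (BANK ENTROPY — the open, load-bearing step).

## Skeleton (this file; `sorry` ONLY inside the four `stub_*`; composition kernel-checked)

Everything is stated over a Bool adjacency `adj : Fin m → Fin m → Bool` and the landed
`Negative.cliqueCNF m k adj` (the crux's own `let cnf`, `k` a free parameter), with sizes in LOG FORM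
(`log₂ |π| ≥ ε log₂² m` ⇔ `|π| ≥ m^{ε log₂ m}`; scales `M` with `log₂ M ≤ (1-β) log₂ m` ⇔
`M ≤ m^{1-β}`), which keeps the glue to linear arithmetic in the logs.

* `stub_promelRodlCore : PromelRodlCore` — (S2, size L, PUBLISHED: Prömel–Rödl 1999 = LPRT
  arXiv:1303.3166 Lemma 11, p. 9) every `⌈2log₂n⌉`-Ramsey graph has an induced core on `m ≥ n^γ`
  vertices that is TWO-SIDED bi-dense (`δ ≤ d(A,B) ≤ 1-δ` for `|A|,|B| ≥ M`, some `M ≤ m^{1-β}`).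
  The extraction step shared with lines `sound-path-bottleneck` / `drc-selfrich-core`.
* `stub_restrict : Restrict` — (S3, size M, folklore: Ben-Sasson–Wigderson §2.2 restriction, here
  WITH regularity and clause provenance) restricting a regular refutation of `Clique(adj,k)` to the
  induced instance on `range e` gives a regular refutation, no longer, every clause of which descends
  from a clause whose negative support ("remembered ones") lies inside `range e`. Tree support:
  `IsResRefutation.exists_map_restrict` (length form, same line-by-line map `T`; add: premises of
  `T l` ⊆ premises of `l`, so DAG paths and pivots are inherited ⇒ regular; read off provenance).
* `stub_oneWidthNF : Restrict → OneWidthNF` — (S4, size M, probabilistic method / union bound)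
  a regular refutation with `log₂|π| ≤ ε₁ log₂² m` restricts to an induced instance on `a ≥ m^{1-τ}`
  vertices where EVERY clause has one-width `≤ γ log₂ a`: choose the vertex set `A`, `|A| = ⌈m^{1-τ}⌉`,
  to evade the `≤ |π|` negative supports of size `> γ(1-τ)log₂ m` (each evaded with probability
  `≥ 1 - (|A|/m)^{h}`, union bound `|π|·2^{h}m^{-τh} < 1` for `ε₁ < γτ(1-τ)/2`), then apply `Restrict`.
* `stub_bankEntropy : Persistence → Pinning → BoundedOneWidthLB` — (S7, size XL, OPEN — the bet of the
  line; HARDEST) on a two-sided bi-dense instance (`log₂ M ≤ (1-β)log₂ m`, symmetric irreflexive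
  `adj`, `k ≤ C log₂ m`) every regular refutation of `Clique(adj,k)` all of whose clauses have one-width
  `≤ γ log₂ m` (γ = γ(β,δ,C) chosen by the prover) has `log₂|π| ≥ ε log₂² m`. Intended proof = the
  card's §(2)–(3): ABdRLNR §6 path distribution with `s^{-(1+ε)}`-biased coins on the instance; Case 1
  is empty by the one-width bound; a cheap path must cover `V_{i*}` by shadows of `Θ(log m)` accepted
  vertices of which `≤ γlog₂ m` are open at a time; full-shadow strategies are killed outright by
  ShadowPinning (`< m^{1-β}` candidates per banked shadow, each accepted w.p. `≤ k s^{-1-ε}`), and the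
  general partial-shadow case is the BankEntropy count (merging loses the private unbanked shadow).
  KNOWN GAP (card + all three triagers): today's accounting gives `m^{Θ(β)}` successors (polynomial) in
  the general case; quasi-polynomial is the conjecture.
* PROVED here (no longer stubs): `cliqueFreeOfRefutation_holds : CliqueFreeOfRefutation` (S1: tree
  soundness `not_satisfiable_of_isResRefutation_holds` + the satisfying assignment of a `k`-clique),
  `persistence_holds : Persistence` (S5, TRIAGE r1-3's sharpening "state Persistence in Lean now":
  over the tree's `IsResDerivation` / `IsDagPath` / `pivotsAlong` / `IsRegular`, positive literals are
  gained only at pivots along a DAG path, and under regularity a variable pivoted before position `t`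
  whose positive literal is present at the END of the path is present at position `t` — the bank of
  block `i*` on a path ending in `⋁_v x_{i*,v}` is exactly the set of block-`i*` variables queried so
  far, node-determined and never forgotten, ABdRLNR p. 15) and `pinning_holds : Pinning` (S6:
  ShadowPinning from UPPER density, JunkSetSmall from LOWER density — two double countings; the
  idea's "First lemma", triage-verified). The two bricks enter the composition as the hypotheses of
  `stub_bankEntropy`.
* Composition: `biDenseRegularLB_of : OneWidthNF → BoundedOneWidthLB → BiDenseRegularLB` (the TRANSFER
  target C⁺ of the card, = ABdRLNR §9's deterministic pseudo-randomness question in bi-dense form),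
  `restated_of : CliqueFreeOfRefutation → PromelRodlCore → Restrict → BiDenseRegularLB → Restated`, and
  `RegularResolutionRung_of : RegularResolutionRung` (no hypotheses; concludes the route decl BY NAME).

## Disproof used (Cruxes/RegularResolutionRung/Disproof.lean, cdisprove g2 cycle 1; Negative/ landed)

* `regularResolutionRung_false_without_complement` / `_false_without_graph` (both one-sided versions
  are FALSE, witnesses `G = ⊥`, `G = ⊤`): honoured — the line uses the COMPLEMENT-side refutation `π₂`
  exactly once, in `restated_of`, through `cliqueFreeOfRefutation_holds` applied to `Ḡ`, to certify
  `Ḡ` is `K_k`-free so that `stub_promelRodlCore` (which needs BOTH `G` and `Ḡ` clique-free: `⊥`/`⊤`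
  have no bi-dense core) applies; the graph-side `π₁` is the refutation that is measured.
* Calibration (b) `ε ≤ 2`: respected — every exponent here is existential (`∃ ε > 0`).
* (c) the `min`-form / LPRT Thm 4-with-regular is implied by what the line proves (it bounds `|π₁|`
  alone once `G` is Ramsey), consistent with (a) since Ramsey-ness is used.
* (d) planted dead-end cliques vs hitting-set property 2: not engaged — no property 2, no hitting set;
  the instance class is two-sided bi-density only.
* Landed `Negative/EmptyGraphLines.lean`, `Negative/OneSidedFalse.lean`: IMPORTED (this file reuses
  `Negative.cliqueCNF`, `Negative.digits_of`, `Negative.regularResolutionRung_iff_restated`); no stub is an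
  instance they refute (every stub quantifies over two-sided dense instances or is a structural lemma;
  `⊥`, `⊤` are not bi-dense).
* `ledger negatives --problem PneNP` (5 items: 0988, 0265, 10247, 2493, 2222): unrelated to
  resolution / clique formulas; nothing to avoid.

## Remarks for the lead

* Local vocabulary (`edgeCount`, `LowerDense`, `UpperDense`, `BiDense`, `negSupport` and the named
  statements) is flagged `tree.vendored-fact` by the file audit (Prop-valued defs under `Summit.*`):
  before the first stub lands, vendor the five data/density defs verbatim into a Literature support
  file (suggested `Literature/Combinatorics/SimpleGraph/BiDensity.lean` for `edgeCount`/`*Dense`, and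
  `negSupport` next to `Negative.cliqueCNF`) and re-point; statements do not change.
* Stub workers can copy the tree proof of `IsResRefutation.exists_map_restrict`
  (`Literature/Computability/MetaComplexity/ResolutionRestrictionMap.lean`) for `stub_restrict`; the
  cdisprove v4 evidence `20260815T225032Z-Disproof.lean` (item stmt-PneNP-9818; `ledger workitem
  evidence latest stmt-PneNP-9818 --name Disproof.lean --all`) also contains a brute-force regular
  refutation `bruteRefutation` and `isRegular_of_rank`, useful test objects for `Persistence`.
* Parameter bookkeeping of the composition: `τ := β/2`, `β' := 1 - (1-β)/(1-τ)`, `C' := C/(1-τ)`,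
  `ε_C⁺ := min ε₁ (ε(1-τ)²)`; crux exponent `ε_C⁺(β,δ,3/γ)·γ²` with `(γ, β, δ)` from Prömel–Rödl.
* Input degradation: evidence store / dossier (`run/shared/views/cone/PneNP.md`) / refutations.json
  are not mounted in the planner's jail; the Disproof and triage files were read from the tree.
-/

set_option linter.dupNamespace false

namespace Summit.PneNP.PneNP.Cruxes.RegularResolutionRung.IndelibleZeroBanks

open Finset
open Literature.Computability.MetaComplexity Literature.Computability.Complexity
open Summit.PneNP.PneNP.Theorems.RegularResolutionRung.Negative (cliqueCNF Restated digits_of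
  regularResolutionRung_iff_restated)

open scoped Classical

/-! ## Vocabulary (data-level; `cliqueCNF n k adj` is the landed `Negative.cliqueCNF`: variable
`x_{i,v} ↦ i·n+v`, literal `(x, true)` positive; block clauses `⋁_v x_{i,v}` (`i<k`), functionality
`¬x_{i,u} ∨ ¬x_{i,v}` (`u<v`), edge axioms `¬x_{i,u} ∨ ¬x_{j,v}` (`i ≠ j`, `adj u v = false`, incl. `u=v`)) -/

variable {m : ℕ}

/-- Ordered pair count `e(A,B) = #{(a,b) ∈ A × B : adj a b}` (LPRT Def. 10, ordered version; for
symmetric irreflexive `adj` and `A = B` every edge is counted twice and the diagonal never). -/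
def edgeCount (adj : Fin m → Fin m → Bool) (A B : Finset (Fin m)) : ℕ :=
  ((A ×ˢ B).filter fun p => adj p.1 p.2 = true).card

/-- Lower bi-density at scale `M`: `δ|A||B| ≤ e(A,B)` whenever `|A|,|B| ≥ M` (the Prömel–Rödl half
used by LPRT). -/
def LowerDense (adj : Fin m → Fin m → Bool) (M : ℕ) (δ : ℝ) : Prop :=
  ∀ A B : Finset (Fin m), M ≤ A.card → M ≤ B.card → δ * A.card * B.card ≤ (edgeCount adj A B : ℝ)

/-- Upper bi-density at scale `M`: `e(A,B) ≤ (1-δ)|A||B|` whenever `|A|,|B| ≥ M` (the Prömel–Rödl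
half LPRT discard — "we will only use the lower bound", arXiv:1303.3166 p. 9; the engine of this line:
it is what excludes the complete `(k-1)`-partite graph and the join family of TRIAGE r1-1 §A). -/
def UpperDense (adj : Fin m → Fin m → Bool) (M : ℕ) (δ : ℝ) : Prop :=
  ∀ A B : Finset (Fin m), M ≤ A.card → M ≤ B.card →
    (edgeCount adj A B : ℝ) ≤ (1 - δ) * A.card * B.card

/-- Two-sided bi-density at scale `M` with density `δ`. Monotone in `M` (fewer pairs to check at
larger scales); unsatisfiable at scales `M ≤ 1` for `m ≥ 1`, `δ > 0` (take `A = B = {v}`), so the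
log-form scale hypotheses below are never degenerate. -/
def BiDense (adj : Fin m → Fin m → Bool) (M : ℕ) (δ : ℝ) : Prop :=
  LowerDense adj M δ ∧ UpperDense adj M δ

/-- The NEGATIVE SUPPORT of a clause over the variables of `Clique(·,k)` on `n` vertices: the
vertices `v` such that some `¬x_{i,v}` (`i < k`) occurs in it — in branching-program language the
vertices with a REMEMBERED ONE at the node (ABdRLNR's `⋃_i V¹_i(c)`). Its cardinality is the
ONE-WIDTH of the clause. Junk variables `≥ k·n` (reachable only by weakening) do not count. -/
def negSupport (n k : ℕ) (C : Finset (Literal ℕ)) : Finset (Fin n) :=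
  Finset.univ.filter fun v => ∃ i < k, ((i * n + (v : ℕ), false) : Literal ℕ) ∈ C

/-! ## The seven statements of the line (named `Prop`s, so that stubs and composition are legible;
S1, S5 and S6 are proved below; S2, S3, S4 and S7 are the four registered stubs) -/

/-- **S1 `CliqueFreeOfRefutation`** (PROVED below): a refuted `Clique(G,k)` has no `k`-clique —
soundness of resolution (tree: `not_satisfiable_of_isResRefutation_holds`) plus faithfulness of the
unary encoding (a `k`-clique `s` gives the satisfying assignment `x_{i,v} := [v = s_i]`). This is where
TWO-SIDEDNESS enters the composition (applied to `G` with `π₁` and to `Ḡ` with `π₂`). -/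
def CliqueFreeOfRefutation : Prop :=
  ∀ (n k : ℕ) (G : SimpleGraph (Fin n)) [DecidableRel G.Adj] (π : List (ResLine ℕ)),
    IsResRefutation (cliqueCNF n k fun u v => decide (G.Adj u v)) π → G.CliqueFree k

/-- **S2 `PromelRodlCore`** (stub; Prömel–Rödl 1999, JCTA 88, via LPRT arXiv:1303.3166 Lemma 11 p. 9:
"constants `β, δ > 0` such that if `G` is `c`-Ramsey then there is `S ⊆ V(G)`, `|S| ≥ n^{3/4}`, such
that for all `A,B ⊆ S` with `|A|,|B| ≥ |S|^{1-β}`, `δ ≤ d(A,B) ≤ 1-δ`"), in LOG FORM and with every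
constant existential: every exact-threshold Ramsey graph (`G`, `Ḡ` both `⌈2log₂n⌉`-clique-free; such
`G` is `2.5`-Ramsey for `n ≥ 4`) on `n ≥ n₀` vertices has an induced core, presented by an embedding
`e : Fin m ↪ Fin n`, with `γ log₂ n ≤ log₂ m` and TWO-SIDED bi-density `δ` at some scale `M` with
`log₂ M ≤ (1-β) log₂ m` (take `M := ⌈m^{1-β₀}⌉`, `β := β₀/2`, `γ := 3/4`, halve `δ` to absorb
ordered/diagonal counting). Why it might fail: only through a misreading of PR99's quantifiers
(disjoint vs. arbitrary `A, B`; absorbed by the existential constants) — the theorem itself is in print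
and is exactly what LPRT Thm 3/4 consume. -/
def PromelRodlCore : Prop :=
  ∃ γ : ℝ, 0 < γ ∧ ∃ β : ℝ, 0 < β ∧ β < 1 ∧ ∃ δ : ℝ, 0 < δ ∧ ∃ n₀ : ℕ, ∀ n : ℕ, n₀ ≤ n →
    ∀ (G : SimpleGraph (Fin n)) [DecidableRel G.Adj],
      G.CliqueFree (Nat.clog 2 (n ^ 2)) → Gᶜ.CliqueFree (Nat.clog 2 (n ^ 2)) →
      ∃ (m : ℕ) (e : Fin m ↪ Fin n) (M : ℕ),
        γ * Real.logb 2 n ≤ Real.logb 2 m ∧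
        Real.logb 2 M ≤ (1 - β) * Real.logb 2 m ∧
        BiDense (fun u v => decide (G.Adj (e u) (e v))) M δ

/-- **S3 `Restrict`** (stub; Ben-Sasson–Wigderson 2001 §2.2 restriction of refutations, clique-specific,
WITH regularity and provenance): zero every `x_{i,v}` with `v ∉ range e` and rename `x_{i,e u} ↦ i·a+u`
(`i < k`; junk variables `≥ k·n` shifted to `≥ k·a`). Block clauses restrict to block clauses,
functionality/edge axioms with a vertex outside the range are satisfied (dropped), the others rename to
axioms of `Clique(adj ∘ e, k)` (as finsets; `e` need not be monotone). The line-by-line map of the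
tree's `IsResRefutation.exists_map_restrict` keeps indices, turns satisfied lines into a junk axiom and
resolution on a zeroed pivot into a weakening, so premises only shrink: DAG paths and (renamed,
injectively) pivots are inherited ⇒ REGULARITY is preserved; a surviving clause `e⁻¹(C|ρ)` comes from an
UNSATISFIED `C`, i.e. one with no `¬x_{i,v}`, `v ∉ range e` — its negative support lies inside the
range and is in bijection with that of its image (junk lines: take `l :=` the empty-clause line).
Why it might fail: only by mis-stating the provenance clause (checked on paper for all three rule
cases and for junk lines; `k = 0` is vacuous since `Clique(·,0)` has no clauses hence no refutation). -/
def Restrict : Prop :=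
  ∀ (n a k : ℕ) (adj : Fin n → Fin n → Bool) (e : Fin a ↪ Fin n) (π : List (ResLine ℕ)),
    IsResRefutation (cliqueCNF n k adj) π → IsRegular π →
    ∃ π' : List (ResLine ℕ),
      IsResRefutation (cliqueCNF a k fun u v => adj (e u) (e v)) π' ∧ IsRegular π' ∧
      π'.length ≤ π.length ∧
      ∀ l' ∈ π', ∃ l ∈ π,
        (negSupport a k l'.clause).card ≤ (negSupport n k l.clause).card ∧
        ∀ v ∈ negSupport n k l.clause, v ∈ Set.range e

/-- **S4 `OneWidthNF`** (stub, as `Restrict → OneWidthNF`; the card's ONE-WIDTH NORMAL FORM): for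
`0 < τ < 1`, `γ > 0` there are `ε₁ > 0`, `m₁` such that every regular refutation `π` of `Clique(adj,k)`
on `m ≥ m₁` vertices with `log₂|π| ≤ ε₁ log₂² m` restricts to an induced instance on `a` vertices,
`(1-τ) log₂ m ≤ log₂ a`, with a regular refutation `π'`, `|π'| ≤ |π|`, ALL of whose clauses have
one-width `≤ γ log₂ a`. Proof route: `h := ⌊γ(1-τ)log₂ m⌋ + 1`; the family `F` of negative supports
of clauses of `π` of size `≥ h` has `|F| ≤ |π| ≤ 2^{ε₁ log₂² m}`; an `a`-subset `A ⊆ Fin m`,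
`a := ⌈m^{1-τ}⌉`, containing a given `W`, `|W| ≥ h`, is a `C(m-|W|, a-|W|)/C(m,a) ≤ (a/m)^h ≤ 2^h m^{-τh}`
fraction of all; union bound `< 1` once `ε₁ < γτ(1-τ)/2` and `log₂ m ≥ 2/τ`; apply `Restrict` along
`A.orderEmbOfFin`: a surviving clause descends from one whose negative support lies in `A`, hence has
size `< h ≤ γ(1-τ)log₂ m ≤ γ log₂ a`. Why it might fail: arithmetic only (the counting lemma
"`|F|·(a/m)^h < 1` ⇒ an evading `a`-set exists" is exact). -/
def OneWidthNF : Prop :=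
  ∀ τ γ : ℝ, 0 < τ → τ < 1 → 0 < γ → ∃ ε₁ : ℝ, 0 < ε₁ ∧ ∃ m₁ : ℕ, ∀ m : ℕ, m₁ ≤ m →
    ∀ (adj : Fin m → Fin m → Bool) (k : ℕ) (π : List (ResLine ℕ)),
      IsResRefutation (cliqueCNF m k adj) π → IsRegular π →
      Real.logb 2 π.length ≤ ε₁ * Real.logb 2 m ^ 2 →
      ∃ (a : ℕ) (e : Fin a ↪ Fin m) (π' : List (ResLine ℕ)),
        (1 - τ) * Real.logb 2 m ≤ Real.logb 2 a ∧
        IsResRefutation (cliqueCNF a k fun u v => adj (e u) (e v)) π' ∧ IsRegular π' ∧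
        π'.length ≤ π.length ∧
        ∀ l ∈ π', ((negSupport a k l.clause).card : ℝ) ≤ γ * Real.logb 2 a

/-- **S5 `Persistence`** (PROVED below; TRIAGE r1-3 sharpening "state Persistence in Lean now"):
for a valid derivation `π` and a DAG path `p` (conclusions → premises, `IsDagPath`; all entries are
`< π.length`, the hypotheses `h₀ hₜ hₑ` only name these facts):
(a) MONOTONICITY (no regularity): a positive literal `(x, true)` present at position `t` is present at
position `0` or `x ∈ pivotsAlong π (p.take t)` — reading root-to-leaf, zeros are gained only by
querying (resolvent `E = C∖{x} ∪ D∖{¬x}`: the positive premise `C` exceeds `E` only by `(x,true)`;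
weakening premises are subsets);
(b) INDELIBILITY (regular `π`): if `x ∈ pivotsAlong π (p.take t)` and `(x, true)` is present at the
LAST position, then `(x, true)` is present at position `t` — induct from the end: a premise keeps
`(x,true)` into the resolvent unless `x` is the pivot there, which regularity forbids a second time.
On a path from `∅` to the block axiom `⋁_v x_{i*,v}` this says: the bank `Q(c) = {v : (x_{i*,v}, true)
∈ C_c}` equals the set of block-`i*` variables queried before `c`, and is never forgotten (ABdRLNR
p. 15). Why it might fail: tautological clauses / weakening are allowed by the tree's calculus — both
cases were checked ((x,true) survives `erase (y,false)`; `weaken` premises are subsets). -/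
def Persistence : Prop :=
  ∀ (φ : CNF ℕ) (π : List (ResLine ℕ)) (p : List ℕ),
    IsResDerivation φ π → IsDagPath (π.map ResLine.premises) p →
    (∀ (x t : ℕ) (ht : t < p.length) (h₀ : p[0] < π.length) (hₜ : p[t] < π.length),
        (x, true) ∈ (π[p[t]]).clause →
        (x, true) ∈ (π[p[0]]).clause ∨ x ∈ pivotsAlong π (p.take t)) ∧
    (IsRegular π → ∀ (x t : ℕ) (ht : t < p.length) (hₜ : p[t] < π.length)
        (hₑ : p[p.length - 1] < π.length),
        x ∈ pivotsAlong π (p.take t) →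
        (x, true) ∈ (π[p[p.length - 1]]).clause →
        (x, true) ∈ (π[p[t]]).clause)

/-- **S6 `Pinning`** (PROVED below; the idea's two pinning bricks, one application of each density
inequality): under UPPER density fewer than `M` vertices `w` dominate a set `X`, `|X| ≥ M`, up to
`δ|X|/2` non-neighbours (SHADOW PINNING: else `e(A,X) ≥ (1-δ/2)|A||X| > (1-δ)|A||X|`); under LOWER
density fewer than `M` vertices have `< δ|Y|` neighbours in `Y`, `|Y| ≥ M` (JUNK SET SMALL). -/
def Pinning : Prop :=
  ∀ (m M : ℕ) (δ : ℝ) (adj : Fin m → Fin m → Bool), 0 < M → 0 < δ →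
    (UpperDense adj M δ → ∀ X : Finset (Fin m), M ≤ X.card →
      (Finset.univ.filter fun w =>
        ((X.filter fun v => adj w v = false).card : ℝ) ≤ δ / 2 * X.card).card < M) ∧
    (LowerDense adj M δ → ∀ Y : Finset (Fin m), M ≤ Y.card →
      (Finset.univ.filter fun w =>
        ((Y.filter fun v => adj w v = true).card : ℝ) < δ * Y.card).card < M)

/-- **S7-conclusion `BoundedOneWidthLB`** (the conclusion of the load-bearing stub
`stub_bankEntropy : Persistence → Pinning → BoundedOneWidthLB`): for density parameters `β, δ` and
clique-size slope `C` there are a one-width allowance `γ > 0`, an exponent `ε > 0` and `m₀` such that on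
every symmetric irreflexive instance `adj` on `m ≥ m₀` vertices, two-sided bi-dense with density `δ` at a
scale `M` with `log₂ M ≤ (1-β) log₂ m`, every REGULAR refutation of `Clique(adj,k)`, `k ≤ C log₂ m`,
all of whose clauses have one-width `≤ γ log₂ m`, has `log₂|π| ≥ ε log₂² m`. Vacuous unless `adj` is
`K_k`-free (else no refutation exists), in particular for `k ≤ log₂ m / log₂(2/δ)`. Symmetry is
NECESSARY (a random tournament is bi-dense while its symmetrisation — what the edge axioms see — is
empty). Why it might fail: it is, given `OneWidthNF`, equivalent to the bi-dense transfer `C⁺`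
(ABdRLNR §9's deterministic question) — false iff some two-sided bi-dense `K_k`-free family, `k =
Θ(log m)`, has `m^{o(log m)}` regular refutations; TRIAGE r1-1 §B2 / r1-2 App. B found no such family
(Turán, joins, blow-ups of random `F`, lexicographic products, Paley all consistent). -/
def BoundedOneWidthLB : Prop :=
  ∀ β δ C : ℝ, 0 < β → β < 1 → 0 < δ → 0 < C →
    ∃ γ : ℝ, 0 < γ ∧ ∃ ε : ℝ, 0 < ε ∧ ∃ m₀ : ℕ, ∀ m : ℕ, m₀ ≤ m →
      ∀ (adj : Fin m → Fin m → Bool), (∀ u v, adj u v = adj v u) → (∀ u, adj u u = false) →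
      ∀ M : ℕ, Real.logb 2 M ≤ (1 - β) * Real.logb 2 m → BiDense adj M δ →
      ∀ k : ℕ, (k : ℝ) ≤ C * Real.logb 2 m →
      ∀ π : List (ResLine ℕ), IsResRefutation (cliqueCNF m k adj) π → IsRegular π →
        (∀ l ∈ π, ((negSupport m k l.clause).card : ℝ) ≤ γ * Real.logb 2 m) →
        ε * Real.logb 2 m ^ 2 ≤ Real.logb 2 π.length

/-- **C⁺ `BiDenseRegularLB`** (the card's TRANSFER target, shared with line `sound-path-bottleneck`;
= `SketchIdeator1.BiDenseRegularLB` in log form over Bool adjacencies): two-sided bi-dense instances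
are hard for regular resolution — `log₂|π| ≥ ε log₂² m` for `k ≤ C log₂ m`. PROVED below from
`OneWidthNF` and `BoundedOneWidthLB` (`biDenseRegularLB_of`), and shown to imply the crux
(`restated_of`). EASIER than the crux for this line because both pinning bricks are single applications
of the two Prömel–Rödl inequalities and are stable under the two operations the proof performs
(induced restriction keeps bi-density at the same absolute scale — `biDense_induce`; localisation), and
because the target no longer mentions Ramsey-ness or the threshold `⌈2log₂n⌉`. -/
def BiDenseRegularLB : Prop :=
  ∀ β δ C : ℝ, 0 < β → β < 1 → 0 < δ → 0 < C →
    ∃ ε : ℝ, 0 < ε ∧ ∃ m₀ : ℕ, ∀ m : ℕ, m₀ ≤ m →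
      ∀ (adj : Fin m → Fin m → Bool), (∀ u v, adj u v = adj v u) → (∀ u, adj u u = false) →
      ∀ M : ℕ, Real.logb 2 M ≤ (1 - β) * Real.logb 2 m → BiDense adj M δ →
      ∀ k : ℕ, (k : ℝ) ≤ C * Real.logb 2 m →
      ∀ π : List (ResLine ℕ), IsResRefutation (cliqueCNF m k adj) π → IsRegular π →
        ε * Real.logb 2 m ^ 2 ≤ Real.logb 2 π.length

/-! ## S1 proved: soundness + faithfulness of the unary clique encoding -/

/-- Membership in the coerced vertex list `↑(List.finRange n) : List ℕ` appearing in `cliqueCNF`. -/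
theorem mem_coeList_iff {n : ℕ} {a : ℕ} :
    (a ∈ (do let v ← List.finRange n; pure (v : ℕ) : List ℕ)) ↔ a < n := by
  simp only [List.bind_eq_flatMap, List.pure_def, List.mem_flatMap, List.mem_finRange, true_and,
    List.mem_singleton]
  constructor
  · rintro ⟨v, rfl⟩; exact v.isLt
  · intro h; exact ⟨⟨a, h⟩, rfl⟩

/-- The three clause families of `cliqueCNF`, unfolded. -/
theorem mem_cliqueCNF_cases {n k : ℕ} {adj : Fin n → Fin n → Bool} {c : Clause ℕ}
    (hc : c ∈ cliqueCNF n k adj) :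
    (∃ i < k, c = (do let v ← List.finRange n; pure (v : ℕ) : List ℕ).map fun v => (i * n + v, true)) ∨
    (∃ i < k, ∃ u < n, ∃ v < n, u < v ∧ c = [(i * n + u, false), (i * n + v, false)]) ∨
    (∃ i < k, ∃ j < k, ∃ u v : Fin n, i ≠ j ∧ adj u v = false ∧
      c = [(i * n + (u : ℕ), false), (j * n + (v : ℕ), false)]) := by
  unfold cliqueCNF at hc
  simp only [List.mem_append, List.mem_map, List.mem_flatMap, List.mem_range, List.mem_finRange,
    true_and] at hc
  rcases hc with (⟨i, hi, rfl⟩ | ⟨i, hi, u, hu, v, hv, hc⟩) | ⟨i, hi, j, hj, u, v, hc⟩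
  · exact Or.inl ⟨i, hi, rfl⟩
  · rw [mem_coeList_iff] at hu hv
    by_cases huv : u < v
    · rw [if_pos huv, List.mem_singleton] at hc
      exact Or.inr (Or.inl ⟨i, hi, u, hu, v, hv, huv, hc⟩)
    · rw [if_neg huv] at hc; simp at hc
  · by_cases h : i ≠ j ∧ adj u v = false
    · rw [if_pos h, List.mem_singleton] at hc
      exact Or.inr (Or.inr ⟨i, hi, j, hj, u, v, h.1, h.2, hc⟩)
    · rw [if_neg h] at hc; simp at hc

/-- Faithfulness of the encoding: a `k`-clique `s` gives the satisfying assignment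
`x_{i,v} := [v = s_i]` (`s_i` the `i`-th element of `s`) of `Clique(G,k)`. -/
theorem satisfiable_cliqueCNF_of_clique {n k : ℕ} (G : SimpleGraph (Fin n)) [DecidableRel G.Adj]
    {s : Finset (Fin n)} (hs : G.IsNClique k s) :
    (cliqueCNF n k fun u v => decide (G.Adj u v)).Satisfiable := by
  have hcard : s.card = k := hs.card_eq
  set f : Fin k ↪o Fin n := s.orderEmbOfFin hcard with hf
  have hf_mem : ∀ i, f i ∈ s := fun i => s.orderEmbOfFin_mem hcard i
  let σ : ℕ → Bool := fun x => decide (∃ i : Fin k, x = (i : ℕ) * n + (f i : ℕ))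
  have key : ∀ (i u : ℕ), u < n → ∀ i' : Fin k,
      i * n + u = (i' : ℕ) * n + (f i' : ℕ) → i = i' ∧ u = f i' := by
    intro i u hu i' h
    have h1 := digits_of (s := i) hu
    have h2 := digits_of (s := (i' : ℕ)) (f i').isLt
    rw [h] at h1
    exact ⟨h1.1.symm.trans h2.1, h1.2.symm.trans h2.2⟩
  have σ_true : ∀ (i u : ℕ), u < n → σ (i * n + u) = true →
      ∃ i' : Fin k, (i' : ℕ) = i ∧ (f i' : ℕ) = u := by
    intro i u hu h
    obtain ⟨i', h'⟩ := decide_eq_true_iff.1 h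
    obtain ⟨h1, h2⟩ := key i u hu i' h'
    exact ⟨i', h1.symm, h2.symm⟩
  have σ_self : ∀ i : Fin k, σ ((i : ℕ) * n + (f i : ℕ)) = true := fun i =>
    decide_eq_true_iff.2 ⟨i, rfl⟩
  refine ⟨σ, ?_⟩
  rw [CNF.eval_eq_true_iff]
  intro c hc
  rw [Clause.eval, List.any_eq_true]
  rcases mem_cliqueCNF_cases hc with ⟨i, hi, rfl⟩ | ⟨i, hi, u, hu, v, hv, huv, rfl⟩ |
      ⟨i, hi, j, hj, u, v, hij, hadj, rfl⟩
  · -- block clause `⋁_v x_{i,v}`: the literal `x_{i, f i}` is true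
    refine ⟨(i * n + (f ⟨i, hi⟩ : ℕ), true), ?_, ?_⟩
    · exact List.mem_map.2 ⟨(f ⟨i, hi⟩ : ℕ), mem_coeList_iff.2 (f ⟨i, hi⟩).isLt, rfl⟩
    · have := σ_self ⟨i, hi⟩
      simp only [Literal.eval]
      simpa using this
  · -- functionality: `x_{i,u}`, `x_{i,v}` are not both true for `u ≠ v`
    by_cases h1 : σ (i * n + u) = true
    · refine ⟨(i * n + v, false), by simp, ?_⟩
      obtain ⟨i₁, hi₁, hu₁⟩ := σ_true i u hu h1
      have h2 : σ (i * n + v) = false := by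
        by_contra hcon
        rw [Bool.not_eq_false] at hcon
        obtain ⟨i₂, hi₂, hv₂⟩ := σ_true i v hv hcon
        have : i₁ = i₂ := Fin.ext (hi₁.trans hi₂.symm)
        subst this
        omega
      simp only [Literal.eval]
      simpa using h2
    · refine ⟨(i * n + u, false), by simp, ?_⟩
      rw [Bool.not_eq_true] at h1
      simp only [Literal.eval]
      simpa using h1
  · -- edge axiom for a non-edge in distinct blocks: both true would put a non-edge into the clique
    by_cases h1 : σ (i * n + (u : ℕ)) = true
    · refine ⟨(j * n + (v : ℕ), false), by simp, ?_⟩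
      obtain ⟨i₁, hi₁, hu₁⟩ := σ_true i u u.isLt h1
      have h2 : σ (j * n + (v : ℕ)) = false := by
        by_contra hcon
        rw [Bool.not_eq_false] at hcon
        obtain ⟨i₂, hi₂, hv₂⟩ := σ_true j v v.isLt hcon
        have hne : i₁ ≠ i₂ := by
          intro heq; apply hij; rw [← hi₁, ← hi₂, heq]
        have hfu : f i₁ = u := Fin.ext hu₁
        have hfv : f i₂ = v := Fin.ext hv₂
        have hadj' : G.Adj u v := by
          rw [← hfu, ← hfv]
          exact hs.isClique (hf_mem i₁) (hf_mem i₂) (fun h => hne (f.injective h))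
        have : decide (G.Adj u v) = true := decide_eq_true hadj'
        simp [this] at hadj
      simp only [Literal.eval]
      simpa using h2
    · refine ⟨(i * n + (u : ℕ), false), by simp, ?_⟩
      rw [Bool.not_eq_true] at h1
      simp only [Literal.eval]
      simpa using h1

/-- **S1 proved.** A refuted `Clique(G,k)` has no `k`-clique. -/
theorem cliqueFreeOfRefutation_holds : CliqueFreeOfRefutation := by
  intro n k G _ π hπ s hs
  exact not_satisfiable_of_isResRefutation_holds hπ (satisfiable_cliqueCNF_of_clique G hs)

/-! ## S6 proved: the two pinning bricks (double counting `e(A,B)` row by row) -/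

/-- `e(A,B)` row by row. -/
theorem edgeCount_eq_sum (adj : Fin m → Fin m → Bool) (A B : Finset (Fin m)) :
    edgeCount adj A B = ∑ w ∈ A, (B.filter fun v => adj w v = true).card := by
  unfold edgeCount
  rw [Finset.card_filter, Finset.sum_product]
  refine Finset.sum_congr rfl fun w _ => ?_
  rw [Finset.card_filter]

/-- A row splits into neighbours and non-neighbours. -/
theorem row_split (adj : Fin m → Fin m → Bool) (w : Fin m) (X : Finset (Fin m)) :
    ((X.filter fun v => adj w v = true).card : ℝ) + (X.filter fun v => adj w v = false).card
      = X.card := by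
  have h := Finset.card_filter_add_card_filter_not (s := X) (fun v => adj w v = true)
  have e : (X.filter fun v => ¬ adj w v = true) = X.filter fun v => adj w v = false := by
    refine Finset.filter_congr fun v _ => ?_
    simp
  rw [e] at h
  exact_mod_cast h

/-- **ShadowPinning** (the idea's First lemma): under upper density at scale `M`, fewer than `M`
vertices dominate a set `X` of size `≥ M` up to `δ|X|/2` non-neighbours. -/
theorem shadowPinning {M : ℕ} {δ : ℝ} {adj : Fin m → Fin m → Bool} (hM : 0 < M) (hδ : 0 < δ)
    (hU : UpperDense adj M δ) (X : Finset (Fin m)) (hX : M ≤ X.card) :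
    (Finset.univ.filter fun w =>
      ((X.filter fun v => adj w v = false).card : ℝ) ≤ δ / 2 * X.card).card < M := by
  by_contra hcon
  push Not at hcon
  set A := Finset.univ.filter fun w =>
    ((X.filter fun v => adj w v = false).card : ℝ) ≤ δ / 2 * X.card with hA
  have hup := hU A X hcon hX
  have hrow : ∀ w ∈ A, (1 - δ / 2) * X.card ≤ ((X.filter fun v => adj w v = true).card : ℝ) := by
    intro w hw
    have hw' : ((X.filter fun v => adj w v = false).card : ℝ) ≤ δ / 2 * X.card :=
      (Finset.mem_filter.1 hw).2
    have hs := row_split adj w X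
    linarith
  have hsum : (A.card : ℝ) * ((1 - δ / 2) * X.card) ≤ (edgeCount adj A X : ℝ) := by
    rw [edgeCount_eq_sum, Nat.cast_sum]
    have := Finset.card_nsmul_le_sum A
      (fun w => ((X.filter fun v => adj w v = true).card : ℝ)) _ hrow
    simpa using this
  have hA0 : (0 : ℝ) < A.card := by exact_mod_cast lt_of_lt_of_le hM hcon
  have hX0 : (0 : ℝ) < X.card := by exact_mod_cast lt_of_lt_of_le hM hX
  nlinarith [mul_pos (mul_pos hA0 hX0) hδ]

/-- **JunkSetSmall**: under lower density at scale `M`, fewer than `M` vertices have `< δ|Y|`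
neighbours in a set `Y` of size `≥ M`. -/
theorem junkSetSmall {M : ℕ} {δ : ℝ} {adj : Fin m → Fin m → Bool} (hM : 0 < M)
    (hL : LowerDense adj M δ) (Y : Finset (Fin m)) (hY : M ≤ Y.card) :
    (Finset.univ.filter fun w =>
      ((Y.filter fun v => adj w v = true).card : ℝ) < δ * Y.card).card < M := by
  by_contra hcon
  push Not at hcon
  set J := Finset.univ.filter fun w =>
    ((Y.filter fun v => adj w v = true).card : ℝ) < δ * Y.card with hJ
  have hlow := hL J Y hcon hY
  have hrow : ∀ w ∈ J, ((Y.filter fun v => adj w v = true).card : ℝ) < δ * Y.card :=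
    fun w hw => (Finset.mem_filter.1 hw).2
  have hJne : J.Nonempty := Finset.card_pos.1 (lt_of_lt_of_le hM hcon)
  have hsum : (edgeCount adj J Y : ℝ) < J.card * (δ * Y.card) := by
    rw [edgeCount_eq_sum, Nat.cast_sum]
    calc ∑ w ∈ J, ((Y.filter fun v => adj w v = true).card : ℝ)
        < ∑ _w ∈ J, δ * Y.card := Finset.sum_lt_sum_of_nonempty hJne hrow
      _ = J.card * (δ * Y.card) := by rw [Finset.sum_const, nsmul_eq_mul]
  nlinarith

/-- **S6 proved.** -/
theorem pinning_holds : Pinning := fun _m _M _δ _adj hM hδ =>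
  ⟨fun hU X hX => shadowPinning hM hδ hU X hX, fun hL Y hY => junkSetSmall hM hL Y hY⟩

/-! ## S5 proved: persistence along DAG paths (indelible zeros) -/

section PersistenceProof

variable {φ : CNF ℕ} {π : List (ResLine ℕ)}

/-- One step of a valid derivation: a premise `b` of line `a` is an earlier line, and a positive
literal of the premise survives into line `a` unless its variable is the pivot of line `a`. -/
theorem premise_step (hπ : IsResDerivation φ π) {a : ℕ} (ha : a < π.length) {b : ℕ}
    (hb : b ∈ (π[a]).premises) :
    ∃ hba : b < a, ∀ x : ℕ, (x, true) ∈ (π[b]'(hba.trans ha)).clause →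
      (x, true) ∈ (π[a]).clause ∨ (π[a]).rule.pivot? = some x := by
  have hv := hπ a ha
  unfold IsValidResLine at hv
  unfold ResLine.premises at hb
  split at hv
  · next heq => rw [heq] at hb; simp [ResRule.premises] at hb
  · next i j v heq =>
    obtain ⟨hi, hj, hC, hD, hE⟩ := hv
    have hi' : i < a := by have := hi; simp at this; exact this.1
    have hj' : j < a := by have := hj; simp at this; exact this.1
    rw [heq] at hb
    simp only [ResRule.premises, List.mem_cons, List.not_mem_nil, or_false] at hb
    simp only [List.getElem_take] at hC hD hE
    rcases hb with rfl | rfl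
    · refine ⟨hi', fun x hx => ?_⟩
      by_cases hxv : x = v
      · right; rw [heq, hxv]; rfl
      · left
        rw [hE]
        exact Finset.mem_union_left _ (Finset.mem_erase.2 ⟨fun h => hxv (congrArg Prod.fst h), hx⟩)
    · refine ⟨hj', fun x hx => ?_⟩
      left
      rw [hE]
      exact Finset.mem_union_right _
        (Finset.mem_erase.2 ⟨fun h => Bool.noConfusion (congrArg Prod.snd h), hx⟩)
  · next i heq =>
    obtain ⟨hi, hsub⟩ := hv
    have hi' : i < a := by have := hi; simp at this; exact this.1
    rw [heq] at hb
    simp only [ResRule.premises, List.mem_cons, List.not_mem_nil, or_false] at hb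
    subst hb
    simp only [List.getElem_take] at hsub
    exact ⟨hi', fun x hx => Or.inl (hsub hx)⟩

/-- Entries of a DAG path are line indices. -/
theorem dagPath_lt {p : List ℕ} (hp : IsDagPath (π.map ResLine.premises) p) {t : ℕ}
    (ht : t < p.length) : p[t] < π.length := by
  have := hp.1 (p[t]) (List.getElem_mem _); simpa using this

/-- Consecutive entries of a DAG path: the next entry is a premise of the current one. -/
theorem dagPath_succ {p : List ℕ} (hp : IsDagPath (π.map ResLine.premises) p) {t : ℕ}
    (ht : t + 1 < p.length) :
    p[t + 1] ∈ (π[p[t]]'(dagPath_lt hp (by omega))).premises := by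
  have hrel := List.isChain_iff_getElem.1 hp.2 t ht
  have hlt : p[t] < π.length := dagPath_lt hp (by omega)
  rw [List.getD_eq_getElem?_getD, List.getElem?_map, List.getElem?_eq_getElem hlt] at hrel
  simpa using hrel

/-- The pivot met at position `t` lies in `pivotsAlong π (p.take (t+1))`. -/
theorem mem_pivotsAlong_take_succ {p : List ℕ} {t : ℕ} (ht : t < p.length) (hπt : p[t] < π.length)
    {x : ℕ} (hx : (π[p[t]]).rule.pivot? = some x) : x ∈ pivotsAlong π (p.take (t + 1)) := by
  unfold pivotsAlong
  rw [List.mem_filterMap]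
  refine ⟨p[t], ?_, ?_⟩
  · rw [List.mem_take_iff_getElem]
    exact ⟨t, by simp [ht], rfl⟩
  · rw [List.getElem?_eq_getElem hπt]
    simpa using hx

/-- `pivotsAlong` is monotone along prefixes. -/
theorem pivotsAlong_take_mono {p : List ℕ} {s t : ℕ} (hst : s ≤ t) {x : ℕ}
    (hx : x ∈ pivotsAlong π (p.take s)) : x ∈ pivotsAlong π (p.take t) := by
  unfold pivotsAlong at hx ⊢
  rw [List.mem_filterMap] at hx ⊢
  obtain ⟨i, hi, h⟩ := hx
  exact ⟨i, (List.take_sublist_take_left hst).subset hi, h⟩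

/-- Regularity forbids meeting, at position `t`, a pivot already met on the prefix `p.take t`. -/
theorem not_pivot_again (hreg : IsRegular π) {p : List ℕ} (hp : IsDagPath (π.map ResLine.premises) p)
    {t : ℕ} (ht : t < p.length) {x : ℕ}
    (hx : x ∈ pivotsAlong π (p.take t)) (hpt : (π[p[t]]'(dagPath_lt hp ht)).rule.pivot? = some x) :
    False := by
  have hnd := hreg p hp
  have hsplit : pivotsAlong π p = pivotsAlong π (p.take t) ++ pivotsAlong π (p.drop t) := by
    unfold pivotsAlong
    rw [← List.filterMap_append, List.take_append_drop]
  rw [hsplit, List.nodup_append] at hnd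
  obtain ⟨-, -, hdis⟩ := hnd
  have hx2 : x ∈ pivotsAlong π (p.drop t) := by
    unfold pivotsAlong
    rw [List.mem_filterMap]
    refine ⟨p[t], ?_, ?_⟩
    · rw [List.drop_eq_getElem_cons ht]
      exact List.mem_cons_self
    · rw [List.getElem?_eq_getElem (dagPath_lt hp ht)]
      simpa using hpt
  exact hdis x hx x hx2 rfl

/-- Part (a): positive literals are gained only at pivots (reading conclusions → premises). -/
theorem persistence_mono (hπ : IsResDerivation φ π) {p : List ℕ}
    (hp : IsDagPath (π.map ResLine.premises) p) (x : ℕ) :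
    ∀ (t : ℕ) (ht : t < p.length),
      (x, true) ∈ (π[p[t]]'(dagPath_lt hp ht)).clause →
      (x, true) ∈ (π[p[0]]'(dagPath_lt hp (by omega))).clause ∨ x ∈ pivotsAlong π (p.take t) := by
  intro t
  induction t with
  | zero => intro ht h; exact Or.inl h
  | succ t ih =>
    intro ht h
    have hprem := dagPath_succ hp ht
    obtain ⟨hba, hstep⟩ := premise_step hπ (dagPath_lt hp (by omega)) hprem
    rcases hstep x h with h' | hpiv
    · rcases ih (by omega) h' with h0 | hx
      · exact Or.inl h0
      · exact Or.inr (pivotsAlong_take_mono (Nat.le_succ t) hx)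
    · exact Or.inr (mem_pivotsAlong_take_succ (by omega) (dagPath_lt hp (by omega)) hpiv)

/-- Part (b): under regularity, a pivoted variable whose positive literal is present at the end of the
path is present at every later position (indelible zeros). -/
theorem persistence_indelible (hπ : IsResDerivation φ π) (hreg : IsRegular π) {p : List ℕ}
    (hp : IsDagPath (π.map ResLine.premises) p) (x : ℕ) (hne : 0 < p.length)
    (hend : (x, true) ∈ (π[p[p.length - 1]]'(dagPath_lt hp (by omega))).clause) :
    ∀ (d t : ℕ) (ht : t < p.length), p.length - 1 = t + d →
      x ∈ pivotsAlong π (p.take t) → (x, true) ∈ (π[p[t]]'(dagPath_lt hp ht)).clause := by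
  intro d
  induction d with
  | zero =>
    intro t ht he hx
    have : t = p.length - 1 := by omega
    subst this
    exact hend
  | succ d ih =>
    intro t ht he hx
    have ht1 : t + 1 < p.length := by omega
    have hnext := ih (t + 1) ht1 (by omega) (pivotsAlong_take_mono (Nat.le_succ t) hx)
    have hprem := dagPath_succ hp ht1
    obtain ⟨hba, hstep⟩ := premise_step hπ (dagPath_lt hp ht) hprem
    rcases hstep x hnext with h' | hpiv
    · exact h'
    · exact (not_pivot_again hreg hp ht hx hpiv).elim

/-- **S5 proved.** -/
theorem persistence_holds : Persistence := by
  intro φ π p hπ hp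
  refine ⟨fun x t ht _ _ h => persistence_mono hπ hp x t ht h, ?_⟩
  intro hreg x t ht _ _ hx hend
  exact persistence_indelible hπ hreg hp x (by omega) hend (p.length - 1 - t) t ht (by omega) hx

end PersistenceProof

/-! ## The four stubs (`sorry` only here) -/

/-- **stub_promelRodlCore** (S2; size L; Prömel–Rödl 1999 / LPRT arXiv:1303.3166 Lemma 11, p. 9 —
in print, unformalised; constants existential, `n₀` free). See `PromelRodlCore`. Leans on: Mathlib
`SimpleGraph.CliqueFree`, `Nat.clog`, `Real.logb`; nothing unproved from the tree. The Ramsey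
hypothesis is the crux's own (`G`, `Ḡ` both `⌈2log₂n⌉`-clique-free). -/
theorem stub_promelRodlCore : PromelRodlCore := by
  sorry

/-- **stub_restrict** (S3; size M; folklore restriction lemma, clique-specific, with regularity and
provenance). See `Restrict`. Leans on: tree `IsResRefutation.exists_map_restrict` /
`restrictClause` / `SatisfiedBy` (ResolutionRestrictionMap.lean, ResolutionWidth.lean) — copy its map
`T` with `ρ x := if x < k·n ∧ x % n ∉ range e then some false else none` and the renaming
`i·n + e u ↦ i·a + u`, junk `x ≥ k·n ↦ k·a + (x - k·n)`; `Negative.block_mem` / `edge_mem` for axiom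
membership; `IsRegular`, `pivotsAlong`, `IsDagPath` for the inherited-path argument. -/
theorem stub_restrict : Restrict := by
  sorry

/-- **stub_oneWidthNF** (S4; size M; probabilistic method). See `OneWidthNF`; the hypothesis is the
statement of `stub_restrict` (use it, do not re-prove it). Leans on: Mathlib `Finset.powersetCard`,
`Nat.choose` (`#{A : |A| = a, W ⊆ A} = C(m-|W|, a-|W|)`), `Finset.orderEmbOfFin`, `Real.logb`,
`Nat.ceil`/`Nat.floor`. -/
theorem stub_oneWidthNF : Restrict → OneWidthNF := by
  sorry

/-- **stub_bankEntropy** (S7; size XL; OPEN — the load-bearing bet; HARDEST). See `BoundedOneWidthLB`;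
the hypotheses are the statements of the proved `persistence_holds` and `pinning_holds` (the two
bricks the bank argument is built from; handed over as hypotheses so a worker need not import them). Intended proof (card §(2)–(3), ABdRLNR §6 read on the unary
encoding, block `i*` = the copy `{i*} × V`): random path with `s^{-(1+ε')}`-biased coins,
`s := M`-scale; by the one-width hypothesis every node remembers `≤ γlog₂ m` ones, so (i) reaching a
node costs nothing to bound via Case 1 and (ii) a path ending at the block-`i*` axiom covers `V` (minus
`< t q′` coins and `≤ m^{1-β/2}` vetoed junk, `junkSetSmall`) by shadows `V ∖ N(w)` of `Θ(log m)`
accepted vertices `w`, at most `γ log₂ m` open at a time; by `Persistence` the bank `Q(c)` of a node is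
exactly the set of block-`i*` zeros cast so far and is node-determined; by `shadowPinning` an accepted
vertex whose shadow has been fully banked while the unbanked set was still `≥ M` lies in a
node-determined set of `< M` candidates, each accepted with probability `≤ k s^{-(1+ε')}`, so
`P[path through c] ≤ (M k s^{-1-ε'})^{L(c)}`; FULL-shadow strategies (bank, then forget) are thereby
killed outright; the general partial-shadow/merging case is the BankEntropy count (a merged node keeps
only common ones, losing the unbanked part of private shadows, which must be re-bought). Why it might
fail: the general-case accounting is open (card HONEST GAP: `m^{Θ(β)}` successors proven, quasi-poly
conjectured); the cheapest falsifier is the card's partial-shadow merging schedule on `G(2^{12}, ½)`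
(where ABdRLNR Thm 5.1 forbids a polynomial bank system, so it can only falsify the accounting). -/
theorem stub_bankEntropy : Persistence → Pinning → BoundedOneWidthLB := by
  sorry

/-! ## Glue lemmas (sorry-free) -/

/-- `log₂ n ≥ 1` for `n ≥ 2`. -/
theorem one_le_logb_two {n : ℕ} (h : 2 ≤ n) : 1 ≤ Real.logb 2 (n : ℝ) := by
  have h2 : ((2 : ℕ) : ℝ) ≤ (n : ℝ) := by exact_mod_cast h
  have := Real.logb_le_logb_of_le one_lt_two (by norm_num) h2
  simpa [Real.logb_self_eq_one one_lt_two] using this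

/-- `⌈2 log₂ n⌉ ≤ 2 log₂ n + 1`, via `2^{clog₂(n²) - 1} < n²`. -/
theorem clog_two_sq_le {n : ℕ} (h : 2 ≤ n) :
    ((Nat.clog 2 (n ^ 2) : ℕ) : ℝ) ≤ 2 * Real.logb 2 (n : ℝ) + 1 := by
  have hn2 : 1 < n ^ 2 := by nlinarith
  have hc : 0 < Nat.clog 2 (n ^ 2) := Nat.clog_pos one_lt_two hn2
  have hlt := Nat.pow_pred_clog_lt_self one_lt_two hn2
  rw [Nat.pred_eq_sub_one] at hlt
  have hltR : (2 : ℝ) ^ (Nat.clog 2 (n ^ 2) - 1) < (n : ℝ) ^ 2 := by exact_mod_cast hlt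
  have hpos : (0 : ℝ) < (2 : ℝ) ^ (Nat.clog 2 (n ^ 2) - 1) := by positivity
  have hlog := Real.logb_lt_logb one_lt_two hpos hltR
  rw [Real.logb_pow, Real.logb_pow, Real.logb_self_eq_one one_lt_two, mul_one,
    Nat.cast_sub (by omega), Nat.cast_one] at hlog
  push_cast at hlog ⊢
  linarith

/-- From `⌈2^x⌉₊ ≤ n` conclude `x ≤ log₂ n`. -/
theorem le_logb_of_ceil_rpow_le {x : ℝ} {n : ℕ} (h : ⌈(2 : ℝ) ^ x⌉₊ ≤ n) :
    x ≤ Real.logb 2 (n : ℝ) := by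
  have hx : (0 : ℝ) < (2 : ℝ) ^ x := by positivity
  have h1 : (2 : ℝ) ^ x ≤ (n : ℝ) := (Nat.le_ceil _).trans (by exact_mod_cast h)
  have hn : (0 : ℝ) < (n : ℝ) := hx.trans_le h1
  exact (Real.le_logb_iff_rpow_le one_lt_two hn).2 h1

/-- `log₂ b ≤ log₂ a` for naturals with `0 < a` gives `b ≤ a`. -/
theorem natLe_of_logb_le {a b : ℕ} (ha : 0 < a) (h : Real.logb 2 (b : ℝ) ≤ Real.logb 2 (a : ℝ)) :
    b ≤ a := by
  rcases Nat.eq_zero_or_pos b with rfl | hb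
  · exact Nat.zero_le _
  · have haR : (0 : ℝ) < (a : ℝ) := by exact_mod_cast ha
    have hbR : (0 : ℝ) < (b : ℝ) := by exact_mod_cast hb
    exact_mod_cast (Real.logb_le_logb one_lt_two hbR haR).1 h

/-- A refutation has at least one line (the empty clause). -/
theorem length_pos_of_isResRefutation {φ : CNF ℕ} {π : List (ResLine ℕ)}
    (h : IsResRefutation φ π) : 0 < π.length := by
  obtain ⟨l, hl, -⟩ := h.2
  exact List.length_pos_of_mem hl

/-- Pair counts are preserved under pulling back along an embedding. -/
theorem edgeCount_induce {a m : ℕ} (e : Fin a ↪ Fin m) (adj : Fin m → Fin m → Bool)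
    (A B : Finset (Fin a)) :
    edgeCount (fun u v => adj (e u) (e v)) A B = edgeCount adj (A.map e) (B.map e) := by
  unfold edgeCount
  rw [← Finset.prodMap_map_product, Finset.filter_map, Finset.card_map]
  rfl

/-- Two-sided bi-density at scale `M` is inherited by induced sub-instances (same absolute scale). -/
theorem biDense_induce {a m : ℕ} (e : Fin a ↪ Fin m) {adj : Fin m → Fin m → Bool} {M : ℕ} {δ : ℝ}
    (h : BiDense adj M δ) : BiDense (fun u v => adj (e u) (e v)) M δ := by
  constructor
  · intro A B hA hB
    rw [edgeCount_induce]
    have := h.1 (A.map e) (B.map e) (by simpa using hA) (by simpa using hB)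
    simpa using this
  · intro A B hA hB
    rw [edgeCount_induce]
    have := h.2 (A.map e) (B.map e) (by simpa using hA) (by simpa using hB)
    simpa using this

/-! ## Composition (kernel-checked; `sorry` only inside the four stubs) -/

/-- **C⁺ from the two halves.** `OneWidthNF → BoundedOneWidthLB → BiDenseRegularLB`: given a
regular refutation `π` of a bi-dense instance, either `log₂|π| > ε₁ log₂² m` already, or the one-width
normal form moves it to an induced instance on `a ≥ m^{1-τ}` vertices (`τ := β/2`; bi-density is
inherited at the same absolute scale, which is scale `a^{1-β'}` with `(1-β')(1-τ) = 1-β`), where the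
bounded-one-width lower bound applies. Pure real arithmetic in the logs. -/
theorem biDenseRegularLB_of (hNF : OneWidthNF) (hLB : BoundedOneWidthLB) : BiDenseRegularLB := by
  intro β δ C hβ hβ1 hδ hC
  -- parameters of the two halves
  set τ : ℝ := β / 2 with hτdef
  have hτ0 : 0 < τ := by positivity
  have hτ1 : τ < 1 := by rw [hτdef]; linarith
  have h1τ : 0 < 1 - τ := by linarith
  set β' : ℝ := 1 - (1 - β) / (1 - τ) with hβ'def
  have hquot : (1 - β) / (1 - τ) < 1 := by
    rw [div_lt_one h1τ, hτdef]; linarith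
  have hquot0 : 0 < (1 - β) / (1 - τ) := div_pos (by linarith) h1τ
  have hβ'0 : 0 < β' := by rw [hβ'def]; linarith
  have hβ'1 : β' < 1 := by rw [hβ'def]; linarith
  have hC' : 0 < C / (1 - τ) := div_pos hC h1τ
  obtain ⟨γ, hγ, ε, hε, m₀, hmain⟩ := hLB β' δ (C / (1 - τ)) hβ'0 hβ'1 hδ hC'
  obtain ⟨ε₁, hε₁, m₁, hnf⟩ := hNF τ γ hτ0 hτ1 hγ
  refine ⟨min ε₁ (ε * (1 - τ) ^ 2), lt_min hε₁ (by positivity),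
    max m₁ (max 2 ⌈(2 : ℝ) ^ (Real.logb 2 m₀ / (1 - τ))⌉₊), ?_⟩
  intro m hm adj hsymm hirr M hM hdense k hk π hπ hreg
  have hm₁ : m₁ ≤ m := le_trans (le_max_left _ _) hm
  have hm2 : 2 ≤ m := le_trans (le_trans (le_max_left _ _) (le_max_right _ _)) hm
  have hmceil : ⌈(2 : ℝ) ^ (Real.logb 2 m₀ / (1 - τ))⌉₊ ≤ m :=
    le_trans (le_trans (le_max_right _ _) (le_max_right _ _)) hm
  set L : ℝ := Real.logb 2 m with hLdef
  have hL1 : 1 ≤ L := one_le_logb_two hm2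
  have hL0 : 0 ≤ L := by linarith
  have hLsq : 0 ≤ L ^ 2 := by positivity
  by_cases hcase : Real.logb 2 π.length ≤ ε₁ * L ^ 2
  · -- one-width normal form, then the bounded-one-width bound on the induced instance
    obtain ⟨a, e, π', ha, hπ', hreg', hlen, hwidth⟩ := hnf m hm₁ adj k π hπ hreg hcase
    have h1τL : 0 < (1 - τ) * L := by positivity
    have haR : 0 < (a : ℝ) := by
      by_contra hcon
      push Not at hcon
      have ha0 : (a : ℝ) = 0 := le_antisymm hcon (Nat.cast_nonneg a)
      rw [ha0, Real.logb_zero] at ha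
      linarith
    have hapos : 0 < a := by exact_mod_cast haR
    have ham₀ : m₀ ≤ a := by
      refine natLe_of_logb_le hapos ?_
      have h1 : Real.logb 2 m₀ / (1 - τ) ≤ L := le_logb_of_ceil_rpow_le hmceil
      have h2 : Real.logb 2 m₀ ≤ (1 - τ) * L := by
        rw [div_le_iff₀ h1τ] at h1; linarith
      exact h2.trans ha
    have hsymm' : ∀ u v, (fun u v => adj (e u) (e v)) u v = (fun u v => adj (e u) (e v)) v u :=
      fun u v => hsymm _ _
    have hirr' : ∀ u, (fun u v => adj (e u) (e v)) u u = false := fun u => hirr _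
    have hcoef : 1 - β' = (1 - β) / (1 - τ) := by rw [hβ'def]; ring
    have hM' : Real.logb 2 M ≤ (1 - β') * Real.logb 2 a := by
      rw [hcoef]
      calc Real.logb 2 M ≤ (1 - β) * L := hM
        _ = (1 - β) / (1 - τ) * ((1 - τ) * L) := by field_simp
        _ ≤ (1 - β) / (1 - τ) * Real.logb 2 a := by gcongr
    have hdense' : BiDense (fun u v => adj (e u) (e v)) M δ := biDense_induce e hdense
    have hk' : (k : ℝ) ≤ C / (1 - τ) * Real.logb 2 a := by
      calc (k : ℝ) ≤ C * L := hk
        _ = C / (1 - τ) * ((1 - τ) * L) := by field_simp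
        _ ≤ C / (1 - τ) * Real.logb 2 a := by gcongr
    have key := hmain a ham₀ (fun u v => adj (e u) (e v)) hsymm' hirr' M hM' hdense' k hk' π' hπ'
      hreg' hwidth
    have hlen' : Real.logb 2 π'.length ≤ Real.logb 2 π.length := by
      apply Real.logb_le_logb_of_le one_lt_two
      · exact_mod_cast length_pos_of_isResRefutation hπ'
      · exact_mod_cast hlen
    calc min ε₁ (ε * (1 - τ) ^ 2) * L ^ 2 ≤ ε * (1 - τ) ^ 2 * L ^ 2 := by
          gcongr; exact min_le_right _ _
      _ = ε * ((1 - τ) * L) ^ 2 := by ring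
      _ ≤ ε * Real.logb 2 a ^ 2 := by gcongr
      _ ≤ Real.logb 2 π'.length := key
      _ ≤ Real.logb 2 π.length := hlen'
  · push Not at hcase
    calc min ε₁ (ε * (1 - τ) ^ 2) * L ^ 2 ≤ ε₁ * L ^ 2 := by
          gcongr; exact min_le_left _ _
      _ ≤ Real.logb 2 π.length := hcase.le

/-- **The crux (restated) from the line.** Two-sidedness enters through `CliqueFreeOfRefutation`
(honours `regularResolutionRung_false_without_complement/_graph` of Disproof.lean: the refutation
`π₂` of `Clique(Ḡ,k)` is consumed exactly once, to certify `Ḡ` is `K_k`-free so that the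
Prömel–Rödl core exists); then restrict `π₁` to the core and apply `C⁺` with `C := 3/γ`
(`k = ⌈2log₂ n⌉ ≤ 2log₂ n + 1 ≤ 3 log₂ n ≤ (3/γ) log₂ m`); finally `log₂|π₁| ≥ εγ² log₂² n` is
rewritten as `n^{εγ² log₂ n} ≤ |π₁| ≤ max(|π₁|,|π₂|)`. -/
theorem restated_of (h1 : CliqueFreeOfRefutation) (h2 : PromelRodlCore) (h3 : Restrict)
    (hC : BiDenseRegularLB) : Restated := by
  obtain ⟨γ, hγ, β, hβ, hβ1, δ, hδ, n₀, hcore⟩ := h2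
  obtain ⟨ε, hε, m₀, hmain⟩ := hC β δ (3 / γ) hβ hβ1 hδ (by positivity)
  refine ⟨ε * γ ^ 2, by positivity, max n₀ (max 2 ⌈(2 : ℝ) ^ (Real.logb 2 m₀ / γ)⌉₊), ?_⟩
  intro n hn G inst π₁ π₂ hπ₁ hreg₁ hπ₂ _hreg₂
  have hn₀ : n₀ ≤ n := le_trans (le_max_left _ _) hn
  have hn2 : 2 ≤ n := le_trans (le_trans (le_max_left _ _) (le_max_right _ _)) hn
  have hnceil : ⌈(2 : ℝ) ^ (Real.logb 2 m₀ / γ)⌉₊ ≤ n :=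
    le_trans (le_trans (le_max_right _ _) (le_max_right _ _)) hn
  -- Ramsey-ness of `G` from the two refutations (the only use of `π₂`)
  have hG : G.CliqueFree (Nat.clog 2 (n ^ 2)) := h1 n _ G π₁ hπ₁
  have hGc : Gᶜ.CliqueFree (Nat.clog 2 (n ^ 2)) := h1 n _ Gᶜ π₂ hπ₂
  -- the two-sided bi-dense core
  obtain ⟨m, e, M, hm, hM, hdense⟩ := hcore n hn₀ G hG hGc
  -- restrict `π₁` to the core
  obtain ⟨π', hπ', hreg', hlen, -⟩ :=
    h3 n m (Nat.clog 2 (n ^ 2)) (fun u v => decide (G.Adj u v)) e π₁ hπ₁ hreg₁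
  set L : ℝ := Real.logb 2 n with hLdef
  have hL1 : 1 ≤ L := one_le_logb_two hn2
  have hγL : 0 < γ * L := by positivity
  have hmR : 0 < (m : ℝ) := by
    by_contra hcon
    push Not at hcon
    have hm0 : (m : ℝ) = 0 := le_antisymm hcon (Nat.cast_nonneg m)
    rw [hm0, Real.logb_zero] at hm
    linarith
  have hmpos : 0 < m := by exact_mod_cast hmR
  have hmm₀ : m₀ ≤ m := by
    refine natLe_of_logb_le hmpos ?_
    have h1 : Real.logb 2 m₀ / γ ≤ L := le_logb_of_ceil_rpow_le hnceil
    have h2 : Real.logb 2 m₀ ≤ γ * L := by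
      rw [div_le_iff₀ hγ] at h1; linarith
    exact h2.trans hm
  have hsymm : ∀ u v, (fun u v => decide (G.Adj (e u) (e v))) u v =
      (fun u v => decide (G.Adj (e u) (e v))) v u :=
    fun u v => decide_eq_decide.2 (G.adj_comm _ _)
  have hirr : ∀ u, (fun u v => decide (G.Adj (e u) (e v))) u u = false := fun u => by simp
  have hkC : ((Nat.clog 2 (n ^ 2) : ℕ) : ℝ) ≤ 3 / γ * Real.logb 2 m := by
    calc ((Nat.clog 2 (n ^ 2) : ℕ) : ℝ) ≤ 2 * L + 1 := clog_two_sq_le hn2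
      _ ≤ 3 * L := by linarith
      _ = 3 / γ * (γ * L) := by field_simp
      _ ≤ 3 / γ * Real.logb 2 m := by gcongr
  have key := hmain m hmm₀ (fun u v => decide (G.Adj (e u) (e v))) hsymm hirr M hM hdense _ hkC
    π' hπ' hreg'
  have hlen' : Real.logb 2 π'.length ≤ Real.logb 2 π₁.length := by
    apply Real.logb_le_logb_of_le one_lt_two
    · exact_mod_cast length_pos_of_isResRefutation hπ'
    · exact_mod_cast hlen
  have hlog : ε * γ ^ 2 * L ^ 2 ≤ Real.logb 2 π₁.length := by
    calc ε * γ ^ 2 * L ^ 2 = ε * (γ * L) ^ 2 := by ring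
      _ ≤ ε * Real.logb 2 m ^ 2 := by gcongr
      _ ≤ Real.logb 2 π'.length := key
      _ ≤ Real.logb 2 π₁.length := hlen'
  -- back to the crux's `n ^ (ε' log₂ n) ≤ max |π₁| |π₂|`
  have hnR : 0 < (n : ℝ) := by positivity
  have hπ₁R : 0 < (π₁.length : ℝ) := by exact_mod_cast length_pos_of_isResRefutation hπ₁
  have hfin : (n : ℝ) ^ (ε * γ ^ 2 * Real.logb 2 n) ≤ (π₁.length : ℝ) := by
    have e1 : (n : ℝ) ^ (ε * γ ^ 2 * Real.logb 2 n) =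
        (2 : ℝ) ^ (Real.logb 2 n * (ε * γ ^ 2 * Real.logb 2 n)) := by
      rw [Real.rpow_mul (by norm_num : (0 : ℝ) ≤ 2), Real.rpow_logb (by norm_num) (by norm_num) hnR]
    have e2 : (π₁.length : ℝ) = (2 : ℝ) ^ Real.logb 2 (π₁.length : ℝ) := by
      rw [Real.rpow_logb (by norm_num) (by norm_num) hπ₁R]
    rw [e1, e2]
    apply Real.rpow_le_rpow_of_exponent_le (by norm_num : (1 : ℝ) ≤ 2)
    calc Real.logb 2 n * (ε * γ ^ 2 * Real.logb 2 n) = ε * γ ^ 2 * L ^ 2 := by rw [hLdef]; ring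
      _ ≤ Real.logb 2 π₁.length := hlog
  exact hfin.trans (le_max_left _ _)

/-- **The line closes the crux BY NAME.** Logical shape (four stubs, three proved bricks):
`stub_promelRodlCore → stub_restrict → stub_oneWidthNF → stub_bankEntropy → RegularResolutionRung`,
through `restated_of` (with the proved `cliqueFreeOfRefutation_holds`), `biDenseRegularLB_of` (with
`stub_oneWidthNF stub_restrict` and `stub_bankEntropy persistence_holds pinning_holds`) and the
`Iff.rfl` bridge `Negative.regularResolutionRung_iff_restated`. Stated WITHOUT hypotheses, as
`#h21_check_skeleton` requires. -/
theorem RegularResolutionRung_of :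
    Summit.PneNP.PneNP.Theses.RamseyUncertifiable.RegularResolutionRung :=
  regularResolutionRung_iff_restated.2
    (restated_of cliqueFreeOfRefutation_holds stub_promelRodlCore stub_restrict
      (biDenseRegularLB_of (stub_oneWidthNF stub_restrict)
        (stub_bankEntropy persistence_holds pinning_holds)))

end Summit.PneNP.PneNP.Cruxes.RegularResolutionRung.IndelibleZeroBanks
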